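import Summits.ValiantsHypothesis.ValiantsHypothesis.Theorems.SymPencilPerFourInnerRankNineHyperplaneSection

/-!
# Route `SymPencil` — inner rank on hyperplanes, V: a derivative direction always exists
# (IR9U programme; `--supports` stmt-ValiantsHypothesis-5674 `SdcSuperquadratic`; rung currency
# only — nothing here bears on `VP ≠ VNP`)

`SymPencilPerFourInnerRankNineHyperplaneSection.exists_good_point` needs a pair `δ ∈ U'`, `s` in
the section `F₂₃ ∩ U'` (`F₂₃ = {b₀ = b₁ = 0}`) with `s₀^a δ.2 1 + s₁^a δ.2 0 ≠ 0`.  This file shows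
that such a pair ALWAYS exists when `finrank U' = 7` and the section has points with `a₀ ≠ 0` and
with `a₁ ≠ 0` (`exists_derivative_direction`): otherwise a `2 × 2` elimination (or, in the
degenerate case, the dimension count `finrank (U' ∩ F₂₃) ≥ 6 = finrank F₂₃`, which puts
`(e₀, 0), (e₁, 0)` into `U'`) forces `b₀ = b₁ = 0` on all of `U'`, i.e. `U' ≤ F₂₃`, contradicting
`7 > 6`.  So residual (R3) of the blueprint (`HOME(val-lit)/NOTE-port4g2-CELL-NINE-SEVEN.md` §6)
is EMPTY.

Honest framing: a lemma of the IR9U programme; IR9U/IR9H and the cell `(9,7,8)` stay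
OPEN/conditional; window `27 ≤ sdc(per₄) ≤ 29` UNCHANGED; `VP ≠ VNP` not moved; no summit
statement is proved here.  No definitions, no named facts. [folklore]
-/

noncomputable section

-- single-conjunct layout: Sub = Summit, duplicated namespace component intended
set_option linter.dupNamespace false

namespace Summit.ValiantsHypothesis.ValiantsHypothesis.Theorems.SymPencilPerFourInnerRankNineHyperplaneDirection

open Matrix Finset Module

variable {K : Type*} [Field K]

/-- **A derivative direction exists.**  See the module docstring. [folklore] -/
theorem exists_derivative_direction (U' : Submodule K ((Fin 4 → K) × (Fin 4 → K)))
    (hU : finrank K U' = 7)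
    (h0 : ∃ u ∈ U', u.2 0 = 0 ∧ u.2 1 = 0 ∧ u.1 0 ≠ 0)
    (h1 : ∃ u ∈ U', u.2 0 = 0 ∧ u.2 1 = 0 ∧ u.1 1 ≠ 0) :
    ∃ δ ∈ U', ∃ s ∈ U', s.2 0 = 0 ∧ s.2 1 = 0 ∧ s.1 0 * δ.2 1 + s.1 1 * δ.2 0 ≠ 0 := by
  classical
  by_contra H
  push Not at H
  obtain ⟨s₀, hs₀, hs₀0, hs₀1, ha0⟩ := h0
  obtain ⟨s₁, hs₁, hs₁0, hs₁1, ha1⟩ := h1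
  have E0 : ∀ δ ∈ U', s₀.1 0 * δ.2 1 + s₀.1 1 * δ.2 0 = 0 := fun δ hδ => H δ hδ s₀ hs₀ hs₀0 hs₀1
  have E1 : ∀ δ ∈ U', s₁.1 0 * δ.2 1 + s₁.1 1 * δ.2 0 = 0 := fun δ hδ => H δ hδ s₁ hs₁ hs₁0 hs₁1
  -- the subspace `F = {b₀ = b₁ = 0}` and its dimension
  let π : ((Fin 4 → K) × (Fin 4 → K)) →ₗ[K] (K × K) :=
    ((LinearMap.proj 0 : (Fin 4 → K) →ₗ[K] K) ∘ₗ LinearMap.snd K _ _).prod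
      ((LinearMap.proj 1 : (Fin 4 → K) →ₗ[K] K) ∘ₗ LinearMap.snd K _ _)
  have hπ : ∀ u, π u = (u.2 0, u.2 1) := fun u => rfl
  set F : Submodule K ((Fin 4 → K) × (Fin 4 → K)) := LinearMap.ker π with hFdef
  have hF : ∀ u, u ∈ F ↔ u.2 0 = 0 ∧ u.2 1 = 0 := fun u => by
    rw [hFdef, LinearMap.mem_ker, hπ, Prod.mk_eq_zero]
  have hπsurj : LinearMap.range π = ⊤ := by
    rw [LinearMap.range_eq_top]
    intro c
    refine ⟨(0, Pi.single 0 c.1 + Pi.single 1 c.2), ?_⟩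
    rw [hπ]
    simp
  have hF6 : finrank K F = 6 := by
    have h := LinearMap.finrank_range_add_finrank_ker π
    rw [hπsurj, finrank_top] at h
    simp only [Module.finrank_prod, Module.finrank_fin_fun, Module.finrank_self] at h
    rw [hFdef]
    omega
  -- in all cases `U' ≤ F`
  have hle : U' ≤ F := by
    by_cases hΔ : s₀.1 0 * s₁.1 1 - s₁.1 0 * s₀.1 1 = 0
    · -- degenerate case: `b₁ = ρ b₀` on `U'`, so `U' ∩ {b₀ = 0} ≤ F` has dimension `≥ 6`
      have hs01 : s₀.1 1 ≠ 0 := by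
        intro h
        rw [h, mul_zero, sub_zero] at hΔ
        exact (mul_ne_zero ha0 ha1) hΔ
      let g : U' →ₗ[K] K := ((LinearMap.proj 0 : (Fin 4 → K) →ₗ[K] K) ∘ₗ LinearMap.snd K _ _) ∘ₗ
        U'.subtype
      have hg : ∀ δ : U', g δ = (δ : (Fin 4 → K) × (Fin 4 → K)).2 0 := fun δ => rfl
      have hker6 : 6 ≤ finrank K (LinearMap.ker g) := by
        have h := LinearMap.finrank_range_add_finrank_ker g
        have hr : finrank K (LinearMap.range g) ≤ 1 := by
          have := Submodule.finrank_le (LinearMap.range g)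
          rwa [Module.finrank_self] at this
        rw [hU] at h
        omega
      have hmaple : (LinearMap.ker g).map U'.subtype ≤ F := by
        rintro _ ⟨δ, hδ, rfl⟩
        rw [SetLike.mem_coe, LinearMap.mem_ker, hg] at hδ
        rw [hF, Submodule.coe_subtype]
        refine ⟨hδ, ?_⟩
        have e := E0 δ δ.2
        rw [hδ, mul_zero, add_zero] at e
        exact (mul_eq_zero.1 e).resolve_left ha0
      have hmapeq : (LinearMap.ker g).map U'.subtype = F := by
        refine Submodule.eq_of_le_of_finrank_le hmaple ?_
        rw [hF6, (Submodule.equivMapOfInjective U'.subtype U'.injective_subtype _).finrank_eq.symm]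
        exact hker6
      -- `(e₀, 0)` and `(e₁, 0)` lie in `U'`
      have hmemU : ∀ v : Fin 4 → K, ((v, (0 : Fin 4 → K)) : (Fin 4 → K) × (Fin 4 → K)) ∈ U' := by
        intro v
        have hvF : ((v, (0 : Fin 4 → K)) : (Fin 4 → K) × (Fin 4 → K)) ∈ F := by
          rw [hF]; exact ⟨rfl, rfl⟩
        rw [← hmapeq] at hvF
        obtain ⟨δ, -, hδ⟩ := hvF
        rw [← hδ]
        exact δ.2
      intro δ hδ
      rw [hF]
      have e0 := H δ hδ (Pi.single 0 1, 0) (hmemU _) rfl rfl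
      have e1 := H δ hδ (Pi.single 1 1, 0) (hmemU _) rfl rfl
      simp at e0 e1
      exact ⟨e1, e0⟩
    · intro δ hδ
      rw [hF]
      have e0 := E0 δ hδ
      have e1 := E1 δ hδ
      constructor
      · have : (s₀.1 0 * s₁.1 1 - s₁.1 0 * s₀.1 1) * δ.2 0 = 0 := by
          linear_combination s₀.1 0 * e1 - s₁.1 0 * e0
        exact (mul_eq_zero.1 this).resolve_left hΔ
      · have : (s₀.1 0 * s₁.1 1 - s₁.1 0 * s₀.1 1) * δ.2 1 = 0 := by
          linear_combination s₁.1 1 * e0 - s₀.1 1 * e1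
        exact (mul_eq_zero.1 this).resolve_left hΔ
  have h7 := Submodule.finrank_mono hle
  rw [hU, hF6] at h7
  omega

end Summit.ValiantsHypothesis.ValiantsHypothesis.Theorems.SymPencilPerFourInnerRankNineHyperplaneDirection

end
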